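import Summits.QuantumFields.YangMills.Theorems.UnitScaleTiltProp7GreenPiSupRowsOfLetters
import Summits.QuantumFields.YangMills.Theorems.UnitScaleTiltProp7SectET3DeltaOneT3PInv
import HarnessLib

/-!
# Route `UnitScaleTilt`, crux K1 «MinimiserStabilityRegPr» (stmt-QuantumFields-19200), EX row `norm_G` — NORM_G ROAD N6 (★p1 g27 CHAIR WORDs №24∕№28∕№30), the `T_J` EDITION OF FILE C:
# **THE `(sup, sup∘D*)` ROWS OF `G₁ = (Pᴾ†(Δ^η + T_J)Pᴾ + DR_SD* + Q_k†aQ_k)⁻¹` FROM THOSE OF `G₀`, K-FREE, HÖLDER-FREE, BY THE SAME BOOTSTRAP** — ★p1 g27's ✓p769116 FILE C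
# (`G_π`, print's (3.130)–(3.131)) with the two extra `T_J` terms of `Δ₁ − Δ^η = Δ′ + Pᴾ†T_JPᴾ` ((3.134)–(3.138)): the value row of `T_J` (✓`Prop7TJRowOfColumns`) and its DIVERGENCE row
# (px19 g14 ✓p768852 TJ-DIV) displayed; output = the (V1)∕(Div1) letters of this seat's ✓p769750 (𝔊-ASSEMBLY DOOR) VERBATIM

Cell `ym3-torus` (HUMAN RULING D-0037; rung R3 = SU(2) YM₃ on T³ — NOT d = 4, NOT infinite volume, NOT a mass gap, NOT Clay).  Width seat `ym3-torus-px17` (gen 11); offered 10:55:54Z,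
typed at own risk 11:06Z.  THEOREMS ONLY (0 `def`, 0 `sorry`, default heartbeats); `--supports stmt-QuantumFields-19200 --as helper`; count-neutral.

WHY.  `norm_G` reads `𝔊 = Pᴾ∘G₁ − H₁∘Q_k∘G₁` (✓p768265 N2) at the slot `Δ₁ = Pᴾ†(Δ^η + T_J)Pᴾ` (`DeltaOnePJ = DeltaOneP TJSlotP`); the door ✓p769750 turns the VALUE and DIVERGENCE rows of `G₁` (letters
(V1)∕(Div1)) plus (c2), (Qrow), `norm_H₁` into N1's value letter.  FILE C gives those rows for `G_π` (`T_J = 0`).  THIS FILE adds `T_J`: with `u = G₁f`,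
`Δ_a^η u = f − (Δ₁ − Δ^η)u`, `(Δ₁ − Δ^η)u = (Δ_πᴾ − Δ^η)u + Pᴾ†T_J(Pᴾu)` (✓`DeltaOneP_apply`, ✓`DeltaPiP_apply`), `Pᴾ†y = y − D(R_S(G′ᴾ(D*y)))` (✓FILE C `adjoint_gaugeCorrP_apply`), the two `Δ′`
words (✓FILE C `DeltaPiP_sub_DeltaEta_apply`) and the pure-gauge sources resolved by ✓FILE B `GT_DeltaEtaSlot_DL2_RS_eq` give the SIX-TERM identity
`G₁f = G₀f + G₀(Δ^η(Dλ₁)) + (Dλ₂ − G₀(Δ^η(Dλ₂))) − G₀(T_J(Pᴾu)) + (Dλ₃ − G₀(Δ^η(Dλ₃)))`, `λ₃ := G′ᴾR_SG′ᴾ(D*(T_J(Pᴾu)))`; then FILE C's fixpoint ✓`bootstrap_two` with two more coefficients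
(`‖T_J‖_{∞→∞} ≤ C_T`, `‖D*T_J‖_{∞→∞} ≤ C_{TD}`, both `O(α)` in print) closes the rows under the window
`4αC₁(BV+BD) + ((12α + C_{TD})·C₃·(1 + C₂ + 4αC₁(BV+BD)) + C_T·(BV+BD))·(1 + C₂) ≤ ½` (= FILE C's at `C_T = C_{TD} = 0`).

WHAT IS PROVED (ns `Summit.QuantumFields.YangMills.Theorems.Prop7GreenOneSupRowsOfLetters`; member `F`, `h : n ≤ K`, weights `c₀ cB`, coupling `0 ≤ a`, ANY `T_J` letter `TJ`, background `U₀`).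
* §1 ★★★ `GT_one_eq_six_terms` — the six-term identity on the classes `hp₀ : PosOnto … DeltaEtaSlot U₀`, `hp₁ : PosOnto … (DeltaOneP TJ) U₀`.
* §2 `pointwise_of_six_terms` — abstract value∕divergence assembly (triangle inequalities).
* §3 ★★★★ `valueDiv_rows_GTone_of_letters` — the `(sup, sup∘D*)` rows of `G₁` from FILE C's letters (V)(div)(c1)(c2)(c3) VERBATIM + (tJ) + (tJd) + the window: for every `X` with `‖X b‖ ≤ s`,
  `‖toL2⁻¹(G₁(toL2 X)) b‖ ≤ 2(BV+BD)·s` and `‖toL2S⁻¹(D*G₁(toL2 X)) x‖ ≤ 2(BV+BD)·s` — the (V1)∕(Div1) letters of ✓p769750 with `BV₁ = BD₁ = 2(BV+BD)`.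
HYP-SAT (★★OWNER RULING №42): `RegPr F n K α U₀` (the same `α` in the window; FILE A's (C-val)∕(C-div) numerals `4α`∕`12α`), `0 ≤ a`, `hp₀`∕`hp₁` ⟸ (γ) ✓p767766 (η-slot) ∕ the J-slot road
(CHAIR LOCATE №27: τ-row ⟸ h133), (V)(div) ⟸ N4 ✓p768545 ∕ N5 ✓p768169, (c1)(c2)(c3) ⟸ px5 (c)-package (route editions), (tJ) ⟸ ✓`norm_TJP_apply_le_of_columns`∕`hTJ_of_hHcol_hq` (constant
`2αΘHqA`), (tJd) ⟸ ✓p768852 TJ-DIV (`2αΘHqG`-class), the window = an explicit α-window with K-free constants (class: explicit window).  Conclusions non-vacuous; no `Prop` placeholder.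
HONEST SCOPE.  Algebra + the FILE C bootstrap over displayed letters; no new analysis; nothing of the letters, `norm_G`, the eight EX print rows, `hThm2S`, EX `stub_existenceMinimalOrbit`,
`MinimiserStabilityRegPr` (19200) or R3 is proved; the Yang–Mills mass gap is NOT proved.

References: T. Bałaban, CMP **99** (1985) 389–434 [Balaban1985BackgroundPropagators] ((3.119) p.419, (3.122)–(3.126) p.420, (3.128)–(3.131) pp.421–422, (3.134)–(3.138) pp.422–423,
Thm 3.12 (3.42) pp.422–423); CMP **102** (1985) 277–309 [Balaban1985Variational] ((110)–(111) p.294, (117) p.295).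
-/

set_option autoImplicit false

noncomputable section

open scoped BigOperators Matrix.Norms.L2Operator InnerProductSpace ComplexConjugate

namespace Summit.QuantumFields.YangMills.Theorems.Prop7GreenOneSupRowsOfLetters

open Literature.MathematicalPhysics.QuantumFieldTheory.Balaban1983to89
open Literature.MathematicalPhysics.QuantumFieldTheory.Balaban1983to89.T3ContinuumYM3Torus
open T3PrintedRegularMinimiser (RegPr)
open T3SectALandauChart (eta eta_pos)
open B9Eq311L2Pairing (WL2)
open B11Eq103H1Complex (SiteL2K BondL2K)
open Summit.QuantumFields.YangMills.Theorems.Prop7SectET3Transport (periodsT3)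
open Summit.QuantumFields.YangMills.Theorems.Prop7SectET3HilbertLetters (W₂ toL2 toL2S QL2 DL2 DstarL2 covLapSite adjoint_DL2)
open Summit.QuantumFields.YangMills.Theorems.Prop7SectET3GaugeProjector (NS RS RS_RS)
open Summit.QuantumFields.YangMills.Theorems.Prop7SectET3WilsonHessian (DeltaEta DeltaEtaSlot DeltaEtaSlot_apply)
open Summit.QuantumFields.YangMills.Theorems.Prop7SectET3CurvedPropagators (Qk laplaceA PosOnto GT laplaceA_GT GT_laplaceA)
open Summit.QuantumFields.YangMills.Theorems.Prop7SectET3DeltaPiPInv (kerDProj GprimeP gaugeCorrP DeltaPiP DeltaPiSlotP gaugeCorrP_apply DeltaPiP_apply DeltaPiSlotP_apply)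
open Summit.QuantumFields.YangMills.Theorems.Prop7SectET3DeltaOnePInv (DeltaOneP DeltaOneP_apply)
open Summit.QuantumFields.YangMills.Theorems.Prop7SectET3OpsT3HilbertRows (laplaceA_sub_laplaceA)
open Summit.QuantumFields.YangMills.Theorems.Prop7GreenOnPureGaugeSources (GT_DeltaEtaSlot_DL2_RS_eq covLapSite_GprimeP_RS)
open Summit.QuantumFields.YangMills.Theorems.Prop7CurrentPairingPointwise (norm_symm_DeltaEta_DL2_toL2S_apply_le_of_sup norm_symm_DstarL2_DeltaEta_toL2_apply_le)
open Summit.QuantumFields.YangMills.Theorems.Prop7GreenPiSupRowsOfLetters (adjoint_gaugeCorrP_apply DeltaPiP_sub_DeltaEta_apply covLapSite_lambda₂ bootstrap_two)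

variable {F : T3Family} {n K : ℕ} {h : n ≤ K} {c₀ cB a : ℝ} [Fact (0 < c₀)] [Fact (0 < cB)]
  (TJ : GaugeField (F.P K) 0 (Matrix.specialUnitaryGroup (Fin 2) ℂ) → (BondL2K ℂ 3 (periodsT3 F K) c₀ W₂ →ₗ[ℂ] BondL2K ℂ 3 (periodsT3 F K) c₀ W₂))

/-! ## §1 The six-term identity for `G₁` -/

/-- ★★★ **`G₁f = G₀f + G₀(Δ^η(Dλ₁)) + (Dλ₂ − G₀(Δ^η(Dλ₂))) − G₀(T_J(Pᴾu)) + (Dλ₃ − G₀(Δ^η(Dλ₃)))`**, `u = G₁f`, `λ₁ = G′ᴾR_SD*u`, `λ₂ = G′ᴾR_SG′ᴾ(D*Δ^η(Pᴾu))`,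
`λ₃ = G′ᴾR_SG′ᴾ(D*T_J(Pᴾu))` — the resolvent identity `G₁ = G₀ − G₀(Δ₁ − Δ^η)G₁` with `Δ₁ − Δ^η = (Δ_πᴾ − Δ^η) + Pᴾ†T_JPᴾ` expanded and every pure-gauge source resolved by (G-iii).
[cite: Balaban1985BackgroundPropagators, (3.128)–(3.131) pp.421–422, (3.134)–(3.138) pp.422–423, (3.119) p.419] -/
theorem GT_one_eq_six_terms (ha : 0 ≤ a) {U₀ : GaugeField (F.P K) 0 (Matrix.specialUnitaryGroup (Fin 2) ℂ)}
    (hp₀ : PosOnto F n K h c₀ cB a (DeltaEtaSlot F n K c₀) U₀) (hp₁ : PosOnto F n K h c₀ cB a (DeltaOneP F n K h c₀ cB a TJ) U₀)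
    (f : BondL2K ℂ 3 (periodsT3 F K) c₀ W₂) :
    GT F n K h c₀ cB a (DeltaOneP F n K h c₀ cB a TJ) U₀ f
      = GT F n K h c₀ cB a (DeltaEtaSlot F n K c₀) U₀ f
        + GT F n K h c₀ cB a (DeltaEtaSlot F n K c₀) U₀ (DeltaEta F n K c₀ U₀ (DL2 F n K c₀ U₀ (GprimeP F n K h c₀ cB a U₀ (RS F n K h c₀ cB U₀ (DstarL2 F n K c₀ U₀ (GT F n K h c₀ cB a (DeltaOneP F n K h c₀ cB a TJ) U₀ f))))))
        + (DL2 F n K c₀ U₀ (GprimeP F n K h c₀ cB a U₀ (RS F n K h c₀ cB U₀ (GprimeP F n K h c₀ cB a U₀ (DstarL2 F n K c₀ U₀ (DeltaEta F n K c₀ U₀ (gaugeCorrP F n K h c₀ cB a U₀ (GT F n K h c₀ cB a (DeltaOneP F n K h c₀ cB a TJ) U₀ f)))))))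
          - GT F n K h c₀ cB a (DeltaEtaSlot F n K c₀) U₀ (DeltaEta F n K c₀ U₀ (DL2 F n K c₀ U₀ (GprimeP F n K h c₀ cB a U₀ (RS F n K h c₀ cB U₀ (GprimeP F n K h c₀ cB a U₀ (DstarL2 F n K c₀ U₀ (DeltaEta F n K c₀ U₀ (gaugeCorrP F n K h c₀ cB a U₀ (GT F n K h c₀ cB a (DeltaOneP F n K h c₀ cB a TJ) U₀ f))))))))))
        - GT F n K h c₀ cB a (DeltaEtaSlot F n K c₀) U₀ (TJ U₀ (gaugeCorrP F n K h c₀ cB a U₀ (GT F n K h c₀ cB a (DeltaOneP F n K h c₀ cB a TJ) U₀ f)))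
        + (DL2 F n K c₀ U₀ (GprimeP F n K h c₀ cB a U₀ (RS F n K h c₀ cB U₀ (GprimeP F n K h c₀ cB a U₀ (DstarL2 F n K c₀ U₀ (TJ U₀ (gaugeCorrP F n K h c₀ cB a U₀ (GT F n K h c₀ cB a (DeltaOneP F n K h c₀ cB a TJ) U₀ f)))))))
          - GT F n K h c₀ cB a (DeltaEtaSlot F n K c₀) U₀ (DeltaEta F n K c₀ U₀ (DL2 F n K c₀ U₀ (GprimeP F n K h c₀ cB a U₀ (RS F n K h c₀ cB U₀ (GprimeP F n K h c₀ cB a U₀ (DstarL2 F n K c₀ U₀ (TJ U₀ (gaugeCorrP F n K h c₀ cB a U₀ (GT F n K h c₀ cB a (DeltaOneP F n K h c₀ cB a TJ) U₀ f)))))))))) := by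
  -- `u = G₀(Δ_a^η u)`
  have h1 := GT_laplaceA hp₀ (GT F n K h c₀ cB a (DeltaOneP F n K h c₀ cB a TJ) U₀ f)
  -- `Δ_a^η u = f − (Δ₁u − Δ^ηu)`
  have h2 : laplaceA F n K h c₀ cB a (DeltaEtaSlot F n K c₀) U₀ (GT F n K h c₀ cB a (DeltaOneP F n K h c₀ cB a TJ) U₀ f)
      = f - (DeltaOneP F n K h c₀ cB a TJ U₀ (GT F n K h c₀ cB a (DeltaOneP F n K h c₀ cB a TJ) U₀ f) - DeltaEta F n K c₀ U₀ (GT F n K h c₀ cB a (DeltaOneP F n K h c₀ cB a TJ) U₀ f)) := by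
    have e := congrArg (fun Tm : BondL2K ℂ 3 (periodsT3 F K) c₀ W₂ →ₗ[ℂ] BondL2K ℂ 3 (periodsT3 F K) c₀ W₂ => Tm (GT F n K h c₀ cB a (DeltaOneP F n K h c₀ cB a TJ) U₀ f))
      (laplaceA_sub_laplaceA (h := h) (cB := cB) (a := a) (Δ0x := DeltaOneP F n K h c₀ cB a TJ) (Δπx := DeltaEtaSlot F n K c₀) U₀)
    simp only [LinearMap.sub_apply, DeltaEtaSlot_apply] at e
    rw [← e, laplaceA_GT hp₁ f, sub_sub_cancel]
  -- `Δ₁u − Δ^ηu = (Δ_πᴾu − Δ^ηu) + Pᴾ†(T_J(Pᴾu))`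
  have hS : DeltaOneP F n K h c₀ cB a TJ U₀ (GT F n K h c₀ cB a (DeltaOneP F n K h c₀ cB a TJ) U₀ f) - DeltaEta F n K c₀ U₀ (GT F n K h c₀ cB a (DeltaOneP F n K h c₀ cB a TJ) U₀ f)
      = (DeltaPiP F n K h c₀ cB a U₀ (GT F n K h c₀ cB a (DeltaOneP F n K h c₀ cB a TJ) U₀ f) - DeltaEta F n K c₀ U₀ (GT F n K h c₀ cB a (DeltaOneP F n K h c₀ cB a TJ) U₀ f))
        + LinearMap.adjoint (gaugeCorrP F n K h c₀ cB a U₀) (TJ U₀ (gaugeCorrP F n K h c₀ cB a U₀ (GT F n K h c₀ cB a (DeltaOneP F n K h c₀ cB a TJ) U₀ f))) := by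
    rw [DeltaOneP_apply, map_add, DeltaPiP_apply]
    abel
  have hΔ := DeltaPiP_sub_DeltaEta_apply (h := h) (cB := cB) ha U₀ (GT F n K h c₀ cB a (DeltaOneP F n K h c₀ cB a TJ) U₀ f)
  have hT := adjoint_gaugeCorrP_apply (h := h) (cB := cB) ha U₀ (TJ U₀ (gaugeCorrP F n K h c₀ cB a U₀ (GT F n K h c₀ cB a (DeltaOneP F n K h c₀ cB a TJ) U₀ f)))
  have h3 := GT_DeltaEtaSlot_DL2_RS_eq (h := h) (cB := cB) (a := a) hp₀ ha (GprimeP F n K h c₀ cB a U₀ (DstarL2 F n K c₀ U₀ (DeltaEta F n K c₀ U₀ (gaugeCorrP F n K h c₀ cB a U₀ (GT F n K h c₀ cB a (DeltaOneP F n K h c₀ cB a TJ) U₀ f)))))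
  have h3' := GT_DeltaEtaSlot_DL2_RS_eq (h := h) (cB := cB) (a := a) hp₀ ha (GprimeP F n K h c₀ cB a U₀ (DstarL2 F n K c₀ U₀ (TJ U₀ (gaugeCorrP F n K h c₀ cB a U₀ (GT F n K h c₀ cB a (DeltaOneP F n K h c₀ cB a TJ) U₀ f)))))
  have key : laplaceA F n K h c₀ cB a (DeltaEtaSlot F n K c₀) U₀ (GT F n K h c₀ cB a (DeltaOneP F n K h c₀ cB a TJ) U₀ f)
      = f + DeltaEta F n K c₀ U₀ (DL2 F n K c₀ U₀ (GprimeP F n K h c₀ cB a U₀ (RS F n K h c₀ cB U₀ (DstarL2 F n K c₀ U₀ (GT F n K h c₀ cB a (DeltaOneP F n K h c₀ cB a TJ) U₀ f)))))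
        + DL2 F n K c₀ U₀ (RS F n K h c₀ cB U₀ (GprimeP F n K h c₀ cB a U₀ (DstarL2 F n K c₀ U₀ (DeltaEta F n K c₀ U₀ (gaugeCorrP F n K h c₀ cB a U₀ (GT F n K h c₀ cB a (DeltaOneP F n K h c₀ cB a TJ) U₀ f))))))
        - TJ U₀ (gaugeCorrP F n K h c₀ cB a U₀ (GT F n K h c₀ cB a (DeltaOneP F n K h c₀ cB a TJ) U₀ f))
        + DL2 F n K c₀ U₀ (RS F n K h c₀ cB U₀ (GprimeP F n K h c₀ cB a U₀ (DstarL2 F n K c₀ U₀ (TJ U₀ (gaugeCorrP F n K h c₀ cB a U₀ (GT F n K h c₀ cB a (DeltaOneP F n K h c₀ cB a TJ) U₀ f)))))) := by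
    rw [h2, hS, hΔ, hT]
    abel
  rw [key, map_add, map_sub, map_add, map_add, h3, h3'] at h1
  refine h1.symm.trans ?_
  abel

/-! ## §2 The abstract assembly -/

/-- **VALUE and DIVERGENCE of a six-term sum** `u = G₀f + G₀A₁ + (Dl₂ − G₀A₂) − G₀B + (Dl₃ − G₀A₃)` from termwise bounds (triangle inequalities). [folklore] -/
theorem pointwise_of_six_terms (G₀ : BondL2K ℂ 3 (periodsT3 F K) c₀ W₂ →ₗ[ℂ] BondL2K ℂ 3 (periodsT3 F K) c₀ W₂) (U₀ : GaugeField (F.P K) 0 (Matrix.specialUnitaryGroup (Fin 2) ℂ))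
    (u f A₁ A₂ Dl₂ B Dl₃ A₃ : BondL2K ℂ 3 (periodsT3 F K) c₀ W₂) (h6 : u = G₀ f + G₀ A₁ + (Dl₂ - G₀ A₂) - G₀ B + (Dl₃ - G₀ A₃))
    (b₀ : PBond (F.P K) 0) (x₀ : Site (F.P K) 0)
    {a₀ a₁ a₂ a₃ a₄ a₅ a₆ d₀ d₁ d₂ d₃ d₄ d₅ d₆ : ℝ}
    (hV₀ : ‖(toL2 F K c₀).symm (G₀ f) b₀‖ ≤ a₀) (hV₁ : ‖(toL2 F K c₀).symm (G₀ A₁) b₀‖ ≤ a₁) (hDl₂ : ‖(toL2 F K c₀).symm Dl₂ b₀‖ ≤ a₂)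
    (hV₂ : ‖(toL2 F K c₀).symm (G₀ A₂) b₀‖ ≤ a₃) (hVB : ‖(toL2 F K c₀).symm (G₀ B) b₀‖ ≤ a₄) (hDl₃ : ‖(toL2 F K c₀).symm Dl₃ b₀‖ ≤ a₅)
    (hV₃ : ‖(toL2 F K c₀).symm (G₀ A₃) b₀‖ ≤ a₆)
    (hD₀ : ‖(toL2S F K c₀).symm (DstarL2 F n K c₀ U₀ (G₀ f)) x₀‖ ≤ d₀) (hD₁ : ‖(toL2S F K c₀).symm (DstarL2 F n K c₀ U₀ (G₀ A₁)) x₀‖ ≤ d₁)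
    (hDDl₂ : ‖(toL2S F K c₀).symm (DstarL2 F n K c₀ U₀ Dl₂) x₀‖ ≤ d₂) (hD₂ : ‖(toL2S F K c₀).symm (DstarL2 F n K c₀ U₀ (G₀ A₂)) x₀‖ ≤ d₃)
    (hDB : ‖(toL2S F K c₀).symm (DstarL2 F n K c₀ U₀ (G₀ B)) x₀‖ ≤ d₄) (hDDl₃ : ‖(toL2S F K c₀).symm (DstarL2 F n K c₀ U₀ Dl₃) x₀‖ ≤ d₅)
    (hD₃ : ‖(toL2S F K c₀).symm (DstarL2 F n K c₀ U₀ (G₀ A₃)) x₀‖ ≤ d₆) :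
    ‖(toL2 F K c₀).symm u b₀‖ ≤ a₀ + a₁ + (a₂ + a₃) + a₄ + (a₅ + a₆) ∧
      ‖(toL2S F K c₀).symm (DstarL2 F n K c₀ U₀ u) x₀‖ ≤ d₀ + d₁ + (d₂ + d₃) + d₄ + (d₅ + d₆) := by
  subst h6
  constructor
  · simp only [map_add, map_sub, Pi.add_apply, Pi.sub_apply]
    exact (norm_add_le _ _).trans (add_le_add
      ((norm_sub_le _ _).trans (add_le_add
        ((norm_add_le _ _).trans (add_le_add ((norm_add_le _ _).trans (add_le_add hV₀ hV₁)) ((norm_sub_le _ _).trans (add_le_add hDl₂ hV₂)))) hVB))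
      ((norm_sub_le _ _).trans (add_le_add hDl₃ hV₃)))
  · simp only [map_add, map_sub, Pi.add_apply, Pi.sub_apply]
    exact (norm_add_le _ _).trans (add_le_add
      ((norm_sub_le _ _).trans (add_le_add
        ((norm_add_le _ _).trans (add_le_add ((norm_add_le _ _).trans (add_le_add hD₀ hD₁)) ((norm_sub_le _ _).trans (add_le_add hDDl₂ hD₂)))) hDB))
      ((norm_sub_le _ _).trans (add_le_add hDDl₃ hD₃)))

/-! ## §3 The VALUE and DIVERGENCE rows of `G₁` from the `G₀` rows, the scalar-storey letters and the two `T_J` rows -/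

/-- ★★★★ **THE `(sup, sup∘D*)` ROWS OF `G₁` FROM THOSE OF `G₀`, K-FREE, HÖLDER-FREE** — FILE C's bootstrap with `T_J`.  At `U₀ ∈ RegPr α`, on the classes at the slots `Δ^η` and
`Δ₁ = Pᴾ†(Δ^η + T_J)Pᴾ`, `0 ≤ a`, given FILE C's letters (V)(div)(c1)(c2)(c3) VERBATIM, the VALUE row (tJ) `|T_JY| ≤ C_T·sup|Y|` and the DIVERGENCE row (tJd) `|D*T_JY| ≤ C_TD·sup|Y|`
of the `T_J` letter, and the window `4αC₁(BV+BD) + ((12α + C_TD)·C₃·(1 + C₂ + 4αC₁(BV+BD)) + C_T·(BV+BD))·(1 + C₂) ≤ ½`: for every source `X` with `‖X b‖ ≤ s`,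
`‖(toL2⁻¹(G₁(toL2 X)))(b)‖ ≤ 2(BV+BD)·s` and `‖(toL2S⁻¹(D*G₁(toL2 X)))(x)‖ ≤ 2(BV+BD)·s`.
[cite: Balaban1985BackgroundPropagators, (3.130)–(3.131) pp.421–422, (3.134)–(3.138) pp.422–423, Thm 3.12 (3.42) pp.422–423] -/
theorem valueDiv_rows_GTone_of_letters {α : ℝ} (U₀ : GaugeField (F.P K) 0 (Matrix.specialUnitaryGroup (Fin 2) ℂ)) (hreg : RegPr F n K α U₀) (ha : 0 ≤ a)
    (hp₀ : PosOnto F n K h c₀ cB a (DeltaEtaSlot F n K c₀) U₀) (hp₁ : PosOnto F n K h c₀ cB a (DeltaOneP F n K h c₀ cB a TJ) U₀)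
    {BV BD C₁ C₂ C₃ CT CTD : ℝ} (hBV : 0 ≤ BV) (hBD : 0 ≤ BD) (hC₁ : 0 ≤ C₁) (hC₂ : 0 ≤ C₂) (hC₃ : 0 ≤ C₃) (hCT : 0 ≤ CT) (hCTD : 0 ≤ CTD)
    (hV : ∀ (X : PBond (F.P K) 0 → Matrix (Fin 2) (Fin 2) ℂ) (s : ℝ), (∀ b, ‖X b‖ ≤ s) →
      ∀ b, ‖(toL2 F K c₀).symm (GT F n K h c₀ cB a (DeltaEtaSlot F n K c₀) U₀ (toL2 F K c₀ X)) b‖ ≤ BV * s)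
    (hDiv : ∀ (X : PBond (F.P K) 0 → Matrix (Fin 2) (Fin 2) ℂ) (s : ℝ), (∀ b, ‖X b‖ ≤ s) →
      ∀ x, ‖(toL2S F K c₀).symm (DstarL2 F n K c₀ U₀ (GT F n K h c₀ cB a (DeltaEtaSlot F n K c₀) U₀ (toL2 F K c₀ X))) x‖ ≤ BD * s)
    (hc1 : ∀ (v : Site (F.P K) 0 → Matrix (Fin 2) (Fin 2) ℂ) (m : ℝ), (∀ x, ‖v x‖ ≤ m) →
      ∀ x, ‖(toL2S F K c₀).symm (GprimeP F n K h c₀ cB a U₀ (RS F n K h c₀ cB U₀ (toL2S F K c₀ v))) x‖ ≤ C₁ * m)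
    (hc2 : ∀ (v : Site (F.P K) 0 → Matrix (Fin 2) (Fin 2) ℂ) (m : ℝ), (∀ x, ‖v x‖ ≤ m) →
      ∀ b, ‖(toL2 F K c₀).symm (DL2 F n K c₀ U₀ (GprimeP F n K h c₀ cB a U₀ (RS F n K h c₀ cB U₀ (toL2S F K c₀ v)))) b‖ ≤ C₂ * m)
    (hc3 : ∀ (v : Site (F.P K) 0 → Matrix (Fin 2) (Fin 2) ℂ) (m : ℝ), (∀ x, ‖v x‖ ≤ m) →
      ∀ x, ‖(toL2S F K c₀).symm (RS F n K h c₀ cB U₀ (GprimeP F n K h c₀ cB a U₀ (toL2S F K c₀ v))) x‖ ≤ C₃ * m)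
    (hTJ : ∀ (Y : PBond (F.P K) 0 → Matrix (Fin 2) (Fin 2) ℂ) (s : ℝ), (∀ b, ‖Y b‖ ≤ s) →
      ∀ b, ‖(toL2 F K c₀).symm (TJ U₀ (toL2 F K c₀ Y)) b‖ ≤ CT * s)
    (hTJd : ∀ (Y : PBond (F.P K) 0 → Matrix (Fin 2) (Fin 2) ℂ) (s : ℝ), (∀ b, ‖Y b‖ ≤ s) →
      ∀ x, ‖(toL2S F K c₀).symm (DstarL2 F n K c₀ U₀ (TJ U₀ (toL2 F K c₀ Y))) x‖ ≤ CTD * s)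
    (hwin : 4 * α * C₁ * (BV + BD) + ((12 * α + CTD) * C₃ * (1 + C₂ + 4 * α * C₁ * (BV + BD)) + CT * (BV + BD)) * (1 + C₂) ≤ 1 / 2)
    (X : PBond (F.P K) 0 → Matrix (Fin 2) (Fin 2) ℂ) {s : ℝ} (hX : ∀ b, ‖X b‖ ≤ s) :
    (∀ b, ‖(toL2 F K c₀).symm (GT F n K h c₀ cB a (DeltaOneP F n K h c₀ cB a TJ) U₀ (toL2 F K c₀ X)) b‖ ≤ 2 * (BV + BD) * s) ∧
    (∀ x, ‖(toL2S F K c₀).symm (DstarL2 F n K c₀ U₀ (GT F n K h c₀ cB a (DeltaOneP F n K h c₀ cB a TJ) U₀ (toL2 F K c₀ X))) x‖ ≤ 2 * (BV + BD) * s) := by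
  have hs : 0 ≤ s := (norm_nonneg _).trans (hX ⟨Classical.arbitrary _, 0⟩)
  have hη : 0 < eta F n K := eta_pos F n K
  have hα : 0 ≤ α := by
    have hJ := Prop7DeltaPiDefectPairing.norm_J_one_le_of_regPr U₀ hreg 0 (Classical.arbitrary _)
    have h0 : 0 * eta F n K ^ 3 ≤ α * eta F n K ^ 3 := by rw [zero_mul]; exact (norm_nonneg _).trans hJ
    exact le_of_mul_le_mul_right h0 (pow_pos hη 3)
  -- the six-term identity (before the abbreviations)
  have h6 := GT_one_eq_six_terms TJ (h := h) (cB := cB) ha hp₀ hp₁ (toL2 F K c₀ X)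
  -- the objects
  set f := toL2 F K c₀ X with hf
  set u := GT F n K h c₀ cB a (DeltaOneP F n K h c₀ cB a TJ) U₀ f with hu
  set lam₁ := GprimeP F n K h c₀ cB a U₀ (RS F n K h c₀ cB U₀ (DstarL2 F n K c₀ U₀ u)) with hlam₁
  set j := DstarL2 F n K c₀ U₀ (DeltaEta F n K c₀ U₀ (gaugeCorrP F n K h c₀ cB a U₀ u)) with hj
  set lam₂ := GprimeP F n K h c₀ cB a U₀ (RS F n K h c₀ cB U₀ (GprimeP F n K h c₀ cB a U₀ j)) with hlam₂
  set j₃ := DstarL2 F n K c₀ U₀ (TJ U₀ (gaugeCorrP F n K h c₀ cB a U₀ u)) with hj₃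
  set lam₃ := GprimeP F n K h c₀ cB a U₀ (RS F n K h c₀ cB U₀ (GprimeP F n K h c₀ cB a U₀ j₃)) with hlam₃
  set G₀ := GT F n K h c₀ cB a (DeltaEtaSlot F n K c₀) U₀ with hG₀
  -- the divergence reader and the maximisers
  set V : Site (F.P K) 0 → Matrix (Fin 2) (Fin 2) ℂ := (toL2S F K c₀).symm (DstarL2 F n K c₀ U₀ u) with hVd
  haveI : Nonempty (PBond (F.P K) 0) := ⟨⟨Classical.arbitrary _, 0⟩⟩
  obtain ⟨b₀, -, hb₀⟩ := Finset.exists_max_image Finset.univ (fun b => ‖(toL2 F K c₀).symm u b‖) Finset.univ_nonempty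
  obtain ⟨x₀, -, hx₀⟩ := Finset.exists_max_image Finset.univ (fun x => ‖V x‖) Finset.univ_nonempty
  have hUb : ∀ b, ‖(toL2 F K c₀).symm u b‖ ≤ ‖(toL2 F K c₀).symm u b₀‖ := fun b => hb₀ b (Finset.mem_univ b)
  have hVx : ∀ x, ‖V x‖ ≤ ‖V x₀‖ := fun x => hx₀ x (Finset.mem_univ x)
  have hXV0 : 0 ≤ ‖(toL2 F K c₀).symm u b₀‖ := norm_nonneg _
  have hXD0 : 0 ≤ ‖V x₀‖ := norm_nonneg _
  -- the `Pᴾu` bound `Pb := X_V + C₂·X_D` is nonnegative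
  have hPb0 : 0 ≤ ‖(toL2 F K c₀).symm u b₀‖ + C₂ * ‖V x₀‖ := add_nonneg hXV0 (mul_nonneg hC₂ hXD0)
  -- (c1)(c2) on `λ₁ = G′ᴾR_S(toL2S V)`
  have hVeq : toL2S F K c₀ V = DstarL2 F n K c₀ U₀ u := LinearEquiv.apply_symm_apply _ _
  have hlam₁V : lam₁ = GprimeP F n K h c₀ cB a U₀ (RS F n K h c₀ cB U₀ (toL2S F K c₀ V)) := by rw [hVeq]
  have hl₁ : ∀ x, ‖(toL2S F K c₀).symm lam₁ x‖ ≤ C₁ * ‖V x₀‖ := fun x => by rw [hlam₁V]; exact hc1 V ‖V x₀‖ hVx x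
  have hDl₁ : ∀ b, ‖(toL2 F K c₀).symm (DL2 F n K c₀ U₀ lam₁) b‖ ≤ C₂ * ‖V x₀‖ := fun b => by rw [hlam₁V]; exact hc2 V ‖V x₀‖ hVx b
  -- `Pᴾu = u − Dλ₁` pointwise
  set Pu : PBond (F.P K) 0 → Matrix (Fin 2) (Fin 2) ℂ := (toL2 F K c₀).symm (gaugeCorrP F n K h c₀ cB a U₀ u) with hPu
  have hPu_le : ∀ b, ‖Pu b‖ ≤ (‖(toL2 F K c₀).symm u b₀‖ + C₂ * ‖V x₀‖) := by
    intro b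
    have e : Pu b = (toL2 F K c₀).symm u b - (toL2 F K c₀).symm (DL2 F n K c₀ U₀ lam₁) b := by
      rw [hPu, gaugeCorrP_apply, map_sub, Pi.sub_apply]
    rw [e]
    exact (norm_sub_le _ _).trans (add_le_add (hUb b) (hDl₁ b))
  have hPueq : toL2 F K c₀ Pu = gaugeCorrP F n K h c₀ cB a U₀ u := LinearEquiv.apply_symm_apply _ _
  -- (C-div) on `j = D*Δ^η(Pᴾu)`
  have hjle : ∀ x, ‖(toL2S F K c₀).symm j x‖ ≤ 12 * α * (‖(toL2 F K c₀).symm u b₀‖ + C₂ * ‖V x₀‖) := by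
    intro x
    rw [hj, ← hPueq]
    exact norm_symm_DstarL2_DeltaEta_toL2_apply_le U₀ hreg Pu hPu_le x
  -- (tJ)(tJd) on `T_J(Pᴾu)` and `j₃ = D*T_J(Pᴾu)`
  have hTPu : ∀ b, ‖(toL2 F K c₀).symm (TJ U₀ (gaugeCorrP F n K h c₀ cB a U₀ u)) b‖ ≤ CT * (‖(toL2 F K c₀).symm u b₀‖ + C₂ * ‖V x₀‖) := fun b => by
    rw [← hPueq]; exact hTJ Pu (‖(toL2 F K c₀).symm u b₀‖ + C₂ * ‖V x₀‖) hPu_le b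
  have hj₃le : ∀ x, ‖(toL2S F K c₀).symm j₃ x‖ ≤ CTD * (‖(toL2 F K c₀).symm u b₀‖ + C₂ * ‖V x₀‖) := fun x => by
    rw [hj₃, ← hPueq]; exact hTJd Pu (‖(toL2 F K c₀).symm u b₀‖ + C₂ * ‖V x₀‖) hPu_le x
  -- the chains `j ↦ g₂ = R_S G′ᴾ j ↦ λ₂` and `j₃ ↦ g₃ ↦ λ₃` through (c3)(c1)(c2)
  have hchain : ∀ (jj : SiteL2K ℂ 3 (periodsT3 F K) c₀ W₂) (m : ℝ), (∀ x, ‖(toL2S F K c₀).symm jj x‖ ≤ m) →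
      (∀ x, ‖(toL2S F K c₀).symm (RS F n K h c₀ cB U₀ (GprimeP F n K h c₀ cB a U₀ jj)) x‖ ≤ C₃ * m) ∧
      (∀ x, ‖(toL2S F K c₀).symm (GprimeP F n K h c₀ cB a U₀ (RS F n K h c₀ cB U₀ (GprimeP F n K h c₀ cB a U₀ jj))) x‖ ≤ C₁ * (C₃ * m)) ∧
      (∀ b, ‖(toL2 F K c₀).symm (DL2 F n K c₀ U₀ (GprimeP F n K h c₀ cB a U₀ (RS F n K h c₀ cB U₀ (GprimeP F n K h c₀ cB a U₀ jj)))) b‖ ≤ C₂ * (C₃ * m)) := by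
    intro jj m hm
    set Jv : Site (F.P K) 0 → Matrix (Fin 2) (Fin 2) ℂ := (toL2S F K c₀).symm jj with hJv
    have hJveq : toL2S F K c₀ Jv = jj := LinearEquiv.apply_symm_apply _ _
    have hg : ∀ x, ‖(toL2S F K c₀).symm (RS F n K h c₀ cB U₀ (GprimeP F n K h c₀ cB a U₀ jj)) x‖ ≤ C₃ * m := fun x => by
      rw [← hJveq]; exact hc3 Jv m hm x
    set Gv : Site (F.P K) 0 → Matrix (Fin 2) (Fin 2) ℂ := (toL2S F K c₀).symm (RS F n K h c₀ cB U₀ (GprimeP F n K h c₀ cB a U₀ jj)) with hGv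
    have hGveq : toL2S F K c₀ Gv = RS F n K h c₀ cB U₀ (GprimeP F n K h c₀ cB a U₀ jj) := LinearEquiv.apply_symm_apply _ _
    have hlamG : GprimeP F n K h c₀ cB a U₀ (RS F n K h c₀ cB U₀ (GprimeP F n K h c₀ cB a U₀ jj)) = GprimeP F n K h c₀ cB a U₀ (RS F n K h c₀ cB U₀ (toL2S F K c₀ Gv)) := by
      rw [hGveq, RS_RS]
    refine ⟨hg, fun x => ?_, fun b => ?_⟩
    · rw [hlamG]; exact hc1 Gv _ hg x
    · rw [hlamG]; exact hc2 Gv _ hg b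
  obtain ⟨hg₂le, hl₂, hDl₂⟩ := hchain j (12 * α * (‖(toL2 F K c₀).symm u b₀‖ + C₂ * ‖V x₀‖)) hjle
  obtain ⟨hg₃le, hl₃, hDl₃⟩ := hchain j₃ (CTD * (‖(toL2 F K c₀).symm u b₀‖ + C₂ * ‖V x₀‖)) hj₃le
  -- (C-val) on the three defect sources `Δ^η(Dλᵢ)`
  have hsrc : ∀ (lam : SiteL2K ℂ 3 (periodsT3 F K) c₀ W₂) (m : ℝ), (∀ x, ‖(toL2S F K c₀).symm lam x‖ ≤ m) →
      ∀ b, ‖(toL2 F K c₀).symm (DeltaEta F n K c₀ U₀ (DL2 F n K c₀ U₀ lam)) b‖ ≤ 4 * α * m := by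
    intro lam m hm b
    have e : lam = toL2S F K c₀ ((toL2S F K c₀).symm lam) := (LinearEquiv.apply_symm_apply _ _).symm
    rw [e]
    exact norm_symm_DeltaEta_DL2_toL2S_apply_le_of_sup U₀ hreg _ hm b
  have hS₁ := hsrc lam₁ (C₁ * ‖V x₀‖) hl₁
  have hS₂ := hsrc lam₂ (C₁ * (C₃ * (12 * α * (‖(toL2 F K c₀).symm u b₀‖ + C₂ * ‖V x₀‖)))) hl₂
  have hS₃ := hsrc lam₃ (C₁ * (C₃ * (CTD * (‖(toL2 F K c₀).symm u b₀‖ + C₂ * ‖V x₀‖)))) hl₃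
  -- the `G₀` rows on the bounded sources
  have hread : ∀ y : BondL2K ℂ 3 (periodsT3 F K) c₀ W₂, y = toL2 F K c₀ ((toL2 F K c₀).symm y) := fun y => (LinearEquiv.apply_symm_apply _ _).symm
  have hG₀V : ∀ (y : BondL2K ℂ 3 (periodsT3 F K) c₀ W₂) (m : ℝ), (∀ b, ‖(toL2 F K c₀).symm y b‖ ≤ m) → ∀ b, ‖(toL2 F K c₀).symm (G₀ y) b‖ ≤ BV * m := by
    intro y m hm b; rw [hread y]; exact hV _ _ hm b
  have hG₀D : ∀ (y : BondL2K ℂ 3 (periodsT3 F K) c₀ W₂) (m : ℝ), (∀ b, ‖(toL2 F K c₀).symm y b‖ ≤ m) →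
      ∀ x, ‖(toL2S F K c₀).symm (DstarL2 F n K c₀ U₀ (G₀ y)) x‖ ≤ BD * m := by
    intro y m hm x; rw [hread y]; exact hDiv _ _ hm x
  have hV₀ := hV X s hX
  have hD₀ := hDiv X s hX
  have hV₁ := hG₀V _ _ hS₁
  have hD₁ := hG₀D _ _ hS₁
  have hV₂ := hG₀V _ _ hS₂
  have hD₂ := hG₀D _ _ hS₂
  have hVB := hG₀V _ _ hTPu
  have hDB := hG₀D _ _ hTPu
  have hV₃ := hG₀V _ _ hS₃
  have hD₃ := hG₀D _ _ hS₃
  -- `D*Dλ₂ = g₂`, `D*Dλ₃ = g₃`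
  have hDDl₂ : ∀ x, ‖(toL2S F K c₀).symm (DstarL2 F n K c₀ U₀ (DL2 F n K c₀ U₀ lam₂)) x‖ ≤ C₃ * (12 * α * (‖(toL2 F K c₀).symm u b₀‖ + C₂ * ‖V x₀‖)) := fun x => by
    rw [hlam₂, covLapSite_lambda₂ (h := h) (cB := cB) ha U₀ j]; exact hg₂le x
  have hDDl₃ : ∀ x, ‖(toL2S F K c₀).symm (DstarL2 F n K c₀ U₀ (DL2 F n K c₀ U₀ lam₃)) x‖ ≤ C₃ * (CTD * (‖(toL2 F K c₀).symm u b₀‖ + C₂ * ‖V x₀‖)) := fun x => by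
    rw [hlam₃, covLapSite_lambda₂ (h := h) (cB := cB) ha U₀ j₃]; exact hg₃le x
  -- VALUE and DIVERGENCE at the maximisers
  have hasm := pointwise_of_six_terms (n := n) G₀ U₀ u f _ _ _ _ _ _ h6 b₀ x₀
    (hV₀ b₀) (hV₁ b₀) (hDl₂ b₀) (hV₂ b₀) (hVB b₀) (hDl₃ b₀) (hV₃ b₀)
    (hD₀ x₀) (hD₁ x₀) (hDDl₂ x₀) (hD₂ x₀) (hDB x₀) (hDDl₃ x₀) (hD₃ x₀)
  have hXV : ‖(toL2 F K c₀).symm u b₀‖ ≤ BV * s + BV * (4 * α * (C₁ * ‖V x₀‖)) + (C₂ * (C₃ * (12 * α * (‖(toL2 F K c₀).symm u b₀‖ + C₂ * ‖V x₀‖))) + BV * (4 * α * (C₁ * (C₃ * (12 * α * (‖(toL2 F K c₀).symm u b₀‖ + C₂ * ‖V x₀‖))))))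
      + BV * (CT * (‖(toL2 F K c₀).symm u b₀‖ + C₂ * ‖V x₀‖)) + (C₂ * (C₃ * (CTD * (‖(toL2 F K c₀).symm u b₀‖ + C₂ * ‖V x₀‖))) + BV * (4 * α * (C₁ * (C₃ * (CTD * (‖(toL2 F K c₀).symm u b₀‖ + C₂ * ‖V x₀‖)))))) := hasm.1
  have hXD : ‖V x₀‖ ≤ BD * s + BD * (4 * α * (C₁ * ‖V x₀‖)) + (C₃ * (12 * α * (‖(toL2 F K c₀).symm u b₀‖ + C₂ * ‖V x₀‖)) + BD * (4 * α * (C₁ * (C₃ * (12 * α * (‖(toL2 F K c₀).symm u b₀‖ + C₂ * ‖V x₀‖))))))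
      + BD * (CT * (‖(toL2 F K c₀).symm u b₀‖ + C₂ * ‖V x₀‖)) + (C₃ * (CTD * (‖(toL2 F K c₀).symm u b₀‖ + C₂ * ‖V x₀‖)) + BD * (4 * α * (C₁ * (C₃ * (CTD * (‖(toL2 F K c₀).symm u b₀‖ + C₂ * ‖V x₀‖)))))) := hasm.2
  -- the fixpoint
  have hfix : ‖(toL2 F K c₀).symm u b₀‖ + ‖V x₀‖ ≤ 2 * (BV * s + BD * s) := by
    refine bootstrap_two (XV := ‖(toL2 F K c₀).symm u b₀‖) (XD := ‖V x₀‖) (AV := BV * s) (AD := BD * s) (p := BV * (4 * α * C₁)) (p' := BD * (4 * α * C₁))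
      (q := (12 * α + CTD) * C₃ * (C₂ + BV * (4 * α * C₁)) + BV * CT) (q' := (12 * α + CTD) * C₃ * (1 + BD * (4 * α * C₁)) + BD * CT)
      (C₂ := C₂) (P := (‖(toL2 F K c₀).symm u b₀‖ + C₂ * ‖V x₀‖)) hXV0 hXD0 (by positivity) (by positivity) (by positivity) (by positivity) hC₂ le_rfl ?_ ?_ ?_
    · have : BV * s + BV * (4 * α * (C₁ * ‖V x₀‖)) + (C₂ * (C₃ * (12 * α * (‖(toL2 F K c₀).symm u b₀‖ + C₂ * ‖V x₀‖))) + BV * (4 * α * (C₁ * (C₃ * (12 * α * (‖(toL2 F K c₀).symm u b₀‖ + C₂ * ‖V x₀‖))))))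
          + BV * (CT * (‖(toL2 F K c₀).symm u b₀‖ + C₂ * ‖V x₀‖)) + (C₂ * (C₃ * (CTD * (‖(toL2 F K c₀).symm u b₀‖ + C₂ * ‖V x₀‖))) + BV * (4 * α * (C₁ * (C₃ * (CTD * (‖(toL2 F K c₀).symm u b₀‖ + C₂ * ‖V x₀‖))))))
          = BV * s + BV * (4 * α * C₁) * ‖V x₀‖ + ((12 * α + CTD) * C₃ * (C₂ + BV * (4 * α * C₁)) + BV * CT) * (‖(toL2 F K c₀).symm u b₀‖ + C₂ * ‖V x₀‖) := by ring
      linarith [hXV, this]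
    · have : BD * s + BD * (4 * α * (C₁ * ‖V x₀‖)) + (C₃ * (12 * α * (‖(toL2 F K c₀).symm u b₀‖ + C₂ * ‖V x₀‖)) + BD * (4 * α * (C₁ * (C₃ * (12 * α * (‖(toL2 F K c₀).symm u b₀‖ + C₂ * ‖V x₀‖))))))
          + BD * (CT * (‖(toL2 F K c₀).symm u b₀‖ + C₂ * ‖V x₀‖)) + (C₃ * (CTD * (‖(toL2 F K c₀).symm u b₀‖ + C₂ * ‖V x₀‖)) + BD * (4 * α * (C₁ * (C₃ * (CTD * (‖(toL2 F K c₀).symm u b₀‖ + C₂ * ‖V x₀‖))))))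
          = BD * s + BD * (4 * α * C₁) * ‖V x₀‖ + ((12 * α + CTD) * C₃ * (1 + BD * (4 * α * C₁)) + BD * CT) * (‖(toL2 F K c₀).symm u b₀‖ + C₂ * ‖V x₀‖) := by ring
      linarith [hXD, this]
    · have : BV * (4 * α * C₁) + BD * (4 * α * C₁)
          + (((12 * α + CTD) * C₃ * (C₂ + BV * (4 * α * C₁)) + BV * CT) + ((12 * α + CTD) * C₃ * (1 + BD * (4 * α * C₁)) + BD * CT)) * (1 + C₂)
          = 4 * α * C₁ * (BV + BD) + ((12 * α + CTD) * C₃ * (1 + C₂ + 4 * α * C₁ * (BV + BD)) + CT * (BV + BD)) * (1 + C₂) := by ring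
      linarith [hwin, this]
  have hfix' : ‖(toL2 F K c₀).symm u b₀‖ + ‖V x₀‖ ≤ 2 * (BV + BD) * s := by linarith [hfix]
  refine ⟨fun b => ?_, fun x => ?_⟩
  · calc ‖(toL2 F K c₀).symm (GT F n K h c₀ cB a (DeltaOneP F n K h c₀ cB a TJ) U₀ (toL2 F K c₀ X)) b‖ = ‖(toL2 F K c₀).symm u b‖ := rfl
      _ ≤ ‖(toL2 F K c₀).symm u b₀‖ := hUb b
      _ ≤ 2 * (BV + BD) * s := by linarith
  · calc ‖(toL2S F K c₀).symm (DstarL2 F n K c₀ U₀ (GT F n K h c₀ cB a (DeltaOneP F n K h c₀ cB a TJ) U₀ (toL2 F K c₀ X))) x‖ = ‖V x‖ := rfl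
      _ ≤ ‖V x₀‖ := hVx x
      _ ≤ 2 * (BV + BD) * s := by linarith

end Summit.QuantumFields.YangMills.Theorems.Prop7GreenOneSupRowsOfLetters

end
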